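import Summits.PneNP.PneNP.Theorems.ConvexRankGatesConvexGateBlindExactLiftingTrianglePlaneLocalAdd

/-!
# Triangle instance — plane-local factorisations: every row meets at least `t` atoms (tight)

Support file for crux `ConvexGateBlind` (stmt-PneNP-10680), open stub `stub_exactLifting` (prover seat 3, session 15);
sequel of `…TrianglePlaneLocalAdd` (`AddSolves`).
ROW-INCIDENCE THEOREM (`triangle_planeLocal_rowIncidence`, registered stub): if a non-negative dictionary on the `t × t` grid
(`2 ≤ t`) satisfies the additive coupling condition `AddSolves`, then for every row `a` at least `t` atoms are non-zero on row
`a` (and symmetrically for columns); the `t²` matrix units show the bound is sharp.  Proof: at the pairs `({a}, S)` the row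
`X₀(a,·)` of the solution has `S` as a strict upper level set (`X₀(a,d) ≥ α a + β d > α a > X₀(a,d')`); if fewer than `t`
atoms meet row `a`, the `t` column-vectors `d ↦ (h(a,d))_h` are linearly dependent, `Σ_d μ_d h(a,d) = 0` for every atom;
pairing the relation with `X₀(a,·)` at `S = {μ < 0}` gives `Σ μ > 0` (`addSolves_row_relation_pos`), and at `S = {μ > 0}`
gives `Σ μ < 0`; both sign classes are non-empty because a one-signed relation would make a column of row `a` vanish in every
atom (`addSolves_entry_witness`).  So `Σ_h #rows(h) ≥ t²` (memo `PLANELOCAL-seat3.md` §8(b)).  Nothing here is cited.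
-/

set_option linter.dupNamespace false -- `Summit.PneNP.PneNP.…`: summit = sub-problem (D-0017)

namespace Summit.PneNP.PneNP.Theorems.XorDoor.TriLine

open Finset

variable {t : ℕ}

/-- Every cell of the grid is charged by some atom: otherwise the singleton pair at that cell has no solution. -/
theorem addSolves_entry_witness {ι : Type} [Fintype ι] {H : ι → Fin t → Fin t → ℝ} (hH : ∀ i a d, 0 ≤ H i a d)
    (hA : AddSolves H) (ht : 2 ≤ t) (a d : Fin t) : ∃ i, H i a d ≠ 0 := by
  classical
  haveI : Nontrivial (Fin t) := Fin.nontrivial_iff_two_le.mpr ht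
  obtain ⟨a₀, ha₀⟩ := exists_ne a
  obtain ⟨d₀, hd₀⟩ := exists_ne d
  by_contra hno
  push Not at hno
  obtain ⟨c₀, c₁, α, β, -, hc₁, hadd, hαP, -, hβP, -, -, -⟩ :=
    hA (fun x => decide (x = a)) (fun y => decide (y = d)) ⟨a, by simp⟩ ⟨a₀, by simp [ha₀]⟩ ⟨d, by simp⟩
      ⟨d₀, by simp [hd₀]⟩
  have h0 : ∑ i, c₀ i * H i a d = 0 := sum_eq_zero fun i _ => by rw [hno i, mul_zero]
  have h1 : 0 ≤ ∑ i, c₁ i * H i a d := sum_nonneg fun i _ => mul_nonneg (hc₁ i) (hH i a d)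
  have h2 := hadd a d
  have h3 := hαP a (by simp)
  have h4 := hβP d (by simp)
  linarith

/-- Pairing a linear relation among the columns of row `a` with the solution at the pair `({a}, {μ < 0})`:
the total weight of the relation is positive. -/
theorem addSolves_row_relation_pos {ι : Type} [Fintype ι] {H : ι → Fin t → Fin t → ℝ} (hH : ∀ i a d, 0 ≤ H i a d)
    (hA : AddSolves H) (ht : 2 ≤ t) (a : Fin t) (μ : Fin t → ℝ) (hrel : ∀ i, ∑ d, μ d * H i a d = 0)
    (hneg : ∃ d, μ d < 0) (hpos : ∃ d, 0 < μ d) : 0 < ∑ d, μ d := by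
  classical
  haveI : Nontrivial (Fin t) := Fin.nontrivial_iff_two_le.mpr ht
  obtain ⟨a₀, ha₀⟩ := exists_ne a
  obtain ⟨d₁, hd₁⟩ := hneg
  obtain ⟨d₂, hd₂⟩ := hpos
  obtain ⟨c₀, c₁, α, β, hc₀, hc₁, hadd, hαP, -, hβP, -, hdomB, -⟩ :=
    hA (fun x => decide (x = a)) (fun y => decide (μ y < 0)) ⟨a, by simp⟩ ⟨a₀, by simp [ha₀]⟩ ⟨d₁, by simp [hd₁]⟩
      ⟨d₂, by simp [not_lt.mpr hd₂.le]⟩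
  have hα : 0 < α a := hαP a (by simp)
  -- the row of X₀
  set x₀ : Fin t → ℝ := fun d => ∑ i, c₀ i * H i a d with hx₀
  have hup : ∀ d, μ d < 0 → α a < x₀ d := by
    intro d hd
    have h1 : 0 ≤ ∑ i, c₁ i * H i a d := sum_nonneg fun i _ => mul_nonneg (hc₁ i) (hH i a d)
    have h2 := hadd a d
    have h3 := hβP d (by simp [hd])
    simp only [hx₀]
    linarith
  have hdown : ∀ d, ¬ μ d < 0 → x₀ d < α a := fun d hd => hdomB a d (by simp) (by simp [hd])
  -- pairing: Σ_d μ_d x₀(d) = 0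
  have hpair : ∑ d, μ d * x₀ d = 0 := by
    calc ∑ d, μ d * x₀ d = ∑ d, ∑ i, c₀ i * (μ d * H i a d) := by
          refine sum_congr rfl fun d _ => ?_
          simp only [hx₀]
          rw [mul_sum]
          exact sum_congr rfl fun i _ => by ring
      _ = ∑ i, c₀ i * ∑ d, μ d * H i a d := by
          rw [sum_comm]
          exact sum_congr rfl fun i _ => (mul_sum _ _ _).symm
      _ = 0 := by simp [hrel]
  -- termwise comparison with α a · μ d, strict at d₁
  have hle : ∀ d ∈ (univ : Finset (Fin t)), μ d * x₀ d ≤ μ d * α a := by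
    intro d _
    by_cases hd : μ d < 0
    · exact mul_le_mul_of_nonpos_left (hup d hd).le hd.le
    · exact mul_le_mul_of_nonneg_left (hdown d hd).le (not_lt.mp hd)
  have hlt : ∃ d ∈ (univ : Finset (Fin t)), μ d * x₀ d < μ d * α a :=
    ⟨d₁, mem_univ _, mul_lt_mul_of_neg_left (hup d₁ hd₁) hd₁⟩
  have hsum := sum_lt_sum hle hlt
  rw [hpair, ← sum_mul] at hsum
  -- 0 < (Σ μ) · α with α > 0
  by_contra hneg'
  push Not at hneg'
  have : (∑ d, μ d) * α a ≤ 0 := mul_nonpos_of_nonpos_of_nonneg hneg' hα.le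
  linarith

/-- **Row incidence.**  In a non-negative dictionary satisfying `AddSolves` (`2 ≤ t`), every row meets at least `t` atoms. -/
theorem addSolves_row_incidence {ι : Type} [Fintype ι] [DecidableEq ι] {H : ι → Fin t → Fin t → ℝ}
    (hH : ∀ i a d, 0 ≤ H i a d) (hA : AddSolves H) (ht : 2 ≤ t) (a : Fin t) :
    t ≤ ((univ : Finset ι).filter (fun i => ∃ d, H i a d ≠ 0)).card := by
  classical
  set J : Finset ι := (univ : Finset ι).filter (fun i => ∃ d, H i a d ≠ 0) with hJ
  by_contra hlt
  push Not at hlt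
  -- the t column-vectors of row a, restricted to the atoms meeting the row, are linearly dependent
  let v : Fin t → (J → ℝ) := fun d j => H j.1 a d
  have hdep : ¬ LinearIndependent ℝ v := by
    intro hli
    have h1 := hli.fintype_card_le_finrank
    rw [Module.finrank_fintype_fun_eq_card, Fintype.card_coe, Fintype.card_fin] at h1
    omega
  obtain ⟨μ, hμ, d₀, hd₀⟩ := Fintype.not_linearIndependent_iff.mp hdep
  -- the relation holds against every atom
  have hrel : ∀ i, ∑ d, μ d * H i a d = 0 := by
    intro i
    by_cases hi : i ∈ J
    · have := congrFun hμ ⟨i, hi⟩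
      simpa [v, Finset.sum_apply, smul_eq_mul] using this
    · have hz : ∀ d, H i a d = 0 := by
        intro d
        by_contra hne
        exact hi (by simp only [hJ, mem_filter, mem_univ, true_and]; exact ⟨d, hne⟩)
      simp [hz]
  have hrel' : ∀ i, ∑ d, (-μ d) * H i a d = 0 := fun i => by
    simp only [neg_mul, sum_neg_distrib, hrel i, neg_zero]
  -- both sign classes of μ are non-empty
  have hsigns : (∃ d, μ d < 0) ∧ (∃ d, 0 < μ d) := by
    by_contra hnot
    rw [not_and_or] at hnot
    -- one-signed relation ⇒ the column d₀ of row a vanishes in every atom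
    have hcol : ∀ i, H i a d₀ = 0 := by
      intro i
      rcases hnot with hn | hp
      · push Not at hn
        -- all μ ≥ 0
        have hterm : ∀ d ∈ (univ : Finset (Fin t)), 0 ≤ μ d * H i a d :=
          fun d _ => mul_nonneg (hn d) (hH i a d)
        have h0 := (sum_eq_zero_iff_of_nonneg hterm).mp (hrel i) d₀ (mem_univ _)
        rcases mul_eq_zero.mp h0 with h | h
        · exact absurd h hd₀
        · exact h
      · push Not at hp
        -- all μ ≤ 0
        have hterm : ∀ d ∈ (univ : Finset (Fin t)), 0 ≤ (-μ d) * H i a d :=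
          fun d _ => mul_nonneg (neg_nonneg.mpr (hp d)) (hH i a d)
        have h0 := (sum_eq_zero_iff_of_nonneg hterm).mp (hrel' i) d₀ (mem_univ _)
        rcases mul_eq_zero.mp h0 with h | h
        · exact absurd (neg_eq_zero.mp h) hd₀
        · exact h
    obtain ⟨i, hi⟩ := addSolves_entry_witness hH hA ht a d₀
    exact hi (hcol i)
  obtain ⟨hneg, hpos⟩ := hsigns
  have h1 := addSolves_row_relation_pos hH hA ht a μ hrel hneg hpos
  have h2 := addSolves_row_relation_pos hH hA ht a (fun d => -μ d) hrel'
    (by obtain ⟨d, hd⟩ := hpos; exact ⟨d, by linarith⟩) (by obtain ⟨d, hd⟩ := hneg; exact ⟨d, by linarith⟩)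
  rw [sum_neg_distrib] at h2
  linarith

/-- Registered form (stub `triangle_planeLocal_rowIncidence` of stmt-PneNP-10680): every row of a non-negative dictionary
satisfying the additive coupling condition meets at least `t` atoms (sharp: matrix units). -/
theorem triangle_planeLocal_rowIncidence : ∀ {t : ℕ} {ι : Type} [Fintype ι] [DecidableEq ι] {H : ι → Fin t → Fin t → ℝ}, 2 ≤ t → (∀ i a d, 0 ≤ H i a d) → AddSolves H → ∀ a : Fin t, t ≤ ((Finset.univ : Finset ι).filter (fun i => ∃ d, H i a d ≠ 0)).card :=
  fun ht hH hA a => addSolves_row_incidence hH hA ht a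

end Summit.PneNP.PneNP.Theorems.XorDoor.TriLine
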